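import Literature.MathematicalPhysics.QuantumLattice.MagneticHubbardTorusGauge
import Literature.MathematicalPhysics.QuantumLattice.BdGBondHamiltonian
import Literature.MathematicalPhysics.QuantumLattice.InfVolFermionState
import Mathlib.Algebra.Ring.Action.ConjAct
import HarnessLib

/-!
# Naturality of the site-phase (gauge) automorphisms with respect to second quantisation:
# `W_G · Γ(φ)(Z) · W_Gᴴ = Γ(φ)(W_{G∘φ} · Z · W_{G∘φ}ᴴ)` for EVERY phase function `G`

Topic `Literature/MathematicalPhysics/QuantumLattice` (namespace = path; family `hubbard`). A brick for the two
implementers of symmetries of the lattice-fermion Fock spaces: the isotony / covariance maps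
`Γ(φ) = fermionEmbed φ` of an injection of sites (`InfVolFermionState.lean`) and the site-phase unitaries
`W_g = phaseGauge g` (`MagneticHubbardTorus(Gauge).lean`, `BdGBondHamiltonian.lean`). Companions:
`PhaseGaugeRelabel.lean` (`fermionEmbed_phaseGauge`: `Γ(φ)(W_g) = W_{g'}` for an extension `g'` of `g` BY ONE) and
`PhaseGaugeLocality.lean` (`phaseGauge_conj_eq_of_eqOn`: `W_g A W_gᴴ` depends only on `g` on the support of `A`).
Here the statement needs no condition on `G` off the range of `φ`: both sides of
`W_G Γ(φ)(Z) W_Gᴴ = Γ(φ)(W_{G∘φ} Z W_{G∘φ}ᴴ)` are algebra homomorphisms in `Z` (conjugation by a unit, composed with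
`Γ(φ)`) agreeing on the CAR generators (`c_{xσ} ↦ conj G(φx) · c_{φx,σ}`, `c† ↦ G(φx) · c†`), hence equal
(`algHom_ext_car`). The Summits-side twin for the venture's `gaugeAut` is
`Summit.Ventures.CertifiedManyBodySolver.Rows.gaugeAut_fermionEmbed` (not importable under `Literature/`).

* `phaseGauge_mul_fermionEmbed_mul_conjTranspose` — THE NATURALITY IDENTITY (any `G : Λ' → U(1)`, any `φ : Λ ↪ Λ'`);
* `phaseGauge_mul_fermionEmbed_mul_conjTranspose_of_comp_eq_one` — a gauge TRIVIAL ON THE RANGE of `φ` fixes every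
  embedded observable (`G ∘ φ = 1 ⇒ W_G Γ(φ)(Z) W_Gᴴ = Γ(φ)(Z)`);
* `phaseGauge_mul_conj_mul_conjTranspose` — `W_g (W_gᴴ X W_g) W_gᴴ = X` (stated once, generically, so that the
  `DecidableEq` instance hidden in `1` is the one the gauge lemmas carry).

All PROVED; no definition, no named fact.

## References
* O. Bratteli, D. W. Robinson, *Operator Algebras and Quantum Statistical Mechanics 2* (1997), §5.2.2, Thm. 5.2.5
  (Bogoliubov / gauge automorphisms of the CAR algebra are determined on generators). [cite: BratteliRobinsonII1997, §5.2.2]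
* H. Araki, H. Moriya, Rev. Math. Phys. 15 (2003) 93, §4.1 (local CAR algebras, isotony). [cite: ArakiMoriya2003, §4.1 Def. 4.1–4.3]
* T. Koma, H. Tasaki, PRL 68 (1992) 3248, eqs. (5)–(8) (site-phase unitaries). [cite: KomaTasakiPRL1992, eqs. (7)–(8)]
-/

noncomputable section

namespace Literature.MathematicalPhysics.QuantumLattice

open _root_.Matrix Finset HubbardWave0 Literature.Probability.LatticeModels
open scoped ComplexConjugate

variable {Λ Λ' : Type*} [LinearOrder Λ] [Fintype Λ] [LinearOrder Λ'] [Fintype Λ']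

omit [LinearOrder Λ] [Fintype Λ] in
/-- An orbital is the orbital of its site and spin. [folklore] -/
private theorem orb_ofLex_eq (i : Orb Λ) : orb (ofLex i).1 (ofLex i).2 = i := rfl

/-- **NATURALITY of `Ad(W_G)` with respect to second quantisation**: for every injection of sites `φ : Λ ↪ Λ'`, every
phase function `G : Λ' → U(1)` and every `Z`, `W_G · Γ(φ)(Z) · W_Gᴴ = Γ(φ)(W_{G∘φ} · Z · W_{G∘φ}ᴴ)` — both sides are
algebra homomorphisms in `Z` that send `c_{xσ} ↦ conj G(φx) · c_{φx,σ}` and `c†_{xσ} ↦ G(φx) · c†_{φx,σ}`.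
[cite: BratteliRobinsonII1997, §5.2.2] -/
theorem phaseGauge_mul_fermionEmbed_mul_conjTranspose (G : Λ' → Circle) (φ : Λ ↪ Λ')
    (Z : Matrix (Finset (Orb Λ)) (Finset (Orb Λ)) ℂ) :
    phaseGauge G * fermionEmbed φ Z * (phaseGauge G)ᴴ =
      fermionEmbed φ (phaseGauge (G ∘ φ) * Z * (phaseGauge (G ∘ φ))ᴴ) := by
  -- the two conjugations as algebra homomorphisms: Mathlib's conjugation action of the unit group
  let u' : (Matrix (Finset (Orb Λ')) (Finset (Orb Λ')) ℂ)ˣ :=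
    ⟨phaseGauge G, (phaseGauge G)ᴴ, phaseGauge_mul_conjTranspose_self G, conjTranspose_phaseGauge_mul_self G⟩
  let u : (Matrix (Finset (Orb Λ)) (Finset (Orb Λ)) ℂ)ˣ :=
    ⟨phaseGauge (G ∘ φ), (phaseGauge (G ∘ φ))ᴴ, phaseGauge_mul_conjTranspose_self _,
      conjTranspose_phaseGauge_mul_self _⟩
  have hu' : ∀ X, MulSemiringAction.toAlgHom ℂ _ (ConjAct.toConjAct u') X = phaseGauge G * X * (phaseGauge G)ᴴ :=
    fun X => rfl
  have hu : ∀ X, MulSemiringAction.toAlgHom ℂ _ (ConjAct.toConjAct u) X =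
      phaseGauge (G ∘ φ) * X * (phaseGauge (G ∘ φ))ᴴ := fun X => rfl
  have key : (MulSemiringAction.toAlgHom ℂ _ (ConjAct.toConjAct u')).comp (fermionEmbed φ) =
      (fermionEmbed φ).comp (MulSemiringAction.toAlgHom ℂ _ (ConjAct.toConjAct u)) := by
    refine algHom_ext_car (fun i => ?_) (fun i => ?_)
    · rw [AlgHom.comp_apply, AlgHom.comp_apply, hu', hu, ← orb_ofLex_eq i, fermionEmbed_annihilation,
        phaseGauge_mul_annihilation_mul_conjTranspose, phaseGauge_mul_annihilation_mul_conjTranspose, map_smul,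
        fermionEmbed_annihilation, Function.comp_apply]
    · rw [AlgHom.comp_apply, AlgHom.comp_apply, hu', hu, ← orb_ofLex_eq i, fermionEmbed_creation,
        phaseGauge_mul_creation_mul_conjTranspose, phaseGauge_mul_creation_mul_conjTranspose, map_smul,
        fermionEmbed_creation, Function.comp_apply]
  have := congrArg (fun f : Matrix (Finset (Orb Λ)) (Finset (Orb Λ)) ℂ →ₐ[ℂ]
      Matrix (Finset (Orb Λ')) (Finset (Orb Λ')) ℂ => f Z) key
  simpa only [AlgHom.comp_apply, hu', hu] using this

/-- **A gauge trivial on the range of `φ` fixes every embedded observable**: if `G (φ x) = 1` for all `x` then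
`W_G · Γ(φ)(Z) · W_Gᴴ = Γ(φ)(Z)` (locality of the site-phase unitaries seen through naturality).
[cite: ArakiMoriya2003, §4.1 Def. 4.1–4.3] -/
theorem phaseGauge_mul_fermionEmbed_mul_conjTranspose_of_comp_eq_one (G : Λ' → Circle) (φ : Λ ↪ Λ')
    (hG : ∀ x, G (φ x) = 1) (Z : Matrix (Finset (Orb Λ)) (Finset (Orb Λ)) ℂ) :
    phaseGauge G * fermionEmbed φ Z * (phaseGauge G)ᴴ = fermionEmbed φ Z := by
  have h1 : G ∘ φ = 1 := funext fun x => hG x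
  rw [phaseGauge_mul_fermionEmbed_mul_conjTranspose, h1, phaseGauge_one, conjTranspose_one, Matrix.one_mul,
    Matrix.mul_one]

/-- The symmetric reading: `W_Gᴴ · Γ(φ)(Z) · W_G = Γ(φ)(W_{G∘φ}ᴴ · Z · W_{G∘φ})`. [cite: BratteliRobinsonII1997, §5.2.2] -/
theorem conjTranspose_phaseGauge_mul_fermionEmbed_mul (G : Λ' → Circle) (φ : Λ ↪ Λ')
    (Z : Matrix (Finset (Orb Λ)) (Finset (Orb Λ)) ℂ) :
    (phaseGauge G)ᴴ * fermionEmbed φ Z * phaseGauge G =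
      fermionEmbed φ ((phaseGauge (G ∘ φ))ᴴ * Z * phaseGauge (G ∘ φ)) := by
  have h := phaseGauge_mul_fermionEmbed_mul_conjTranspose G⁻¹ φ Z
  have hc : G⁻¹ ∘ φ = (G ∘ φ)⁻¹ := rfl
  rw [hc, ← phaseGauge_conjTranspose, ← phaseGauge_conjTranspose, conjTranspose_conjTranspose,
    conjTranspose_conjTranspose] at h
  exact h

/-- **`W_g (W_gᴴ X W_g) W_gᴴ = X`** (stated generically, so that the `DecidableEq` instance inside `1` is the one the
gauge lemmas carry). [cite: KomaTasakiPRL1992, eqs. (7)–(8)] -/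
theorem phaseGauge_mul_conj_mul_conjTranspose (g : Λ → Circle) (X : Matrix (Finset (Orb Λ)) (Finset (Orb Λ)) ℂ) :
    phaseGauge g * ((phaseGauge g)ᴴ * X * phaseGauge g) * (phaseGauge g)ᴴ = X := by
  calc phaseGauge g * ((phaseGauge g)ᴴ * X * phaseGauge g) * (phaseGauge g)ᴴ
      = (phaseGauge g * (phaseGauge g)ᴴ) * X * (phaseGauge g * (phaseGauge g)ᴴ) := by simp only [Matrix.mul_assoc]
    _ = X := by rw [phaseGauge_mul_conjTranspose_self, Matrix.one_mul, Matrix.mul_one]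

/-- **`W_gᴴ (W_g X W_gᴴ) W_g = X`**. [cite: KomaTasakiPRL1992, eqs. (7)–(8)] -/
theorem conjTranspose_phaseGauge_mul_conj_mul (g : Λ → Circle) (X : Matrix (Finset (Orb Λ)) (Finset (Orb Λ)) ℂ) :
    (phaseGauge g)ᴴ * (phaseGauge g * X * (phaseGauge g)ᴴ) * phaseGauge g = X := by
  calc (phaseGauge g)ᴴ * (phaseGauge g * X * (phaseGauge g)ᴴ) * phaseGauge g
      = ((phaseGauge g)ᴴ * phaseGauge g) * X * ((phaseGauge g)ᴴ * phaseGauge g) := by simp only [Matrix.mul_assoc]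
    _ = X := by rw [conjTranspose_phaseGauge_mul_self, Matrix.one_mul, Matrix.mul_one]

end Literature.MathematicalPhysics.QuantumLattice

end
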